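import Summits.ResolutionOfSingularities.ResolutionOfSingularities.Theorems.ShallowPort3

/-!
# StalkThread1 — the KERNEL-ZERO stalk chain along a forced tower (Layer A of the tower dictionary), slice 1/2: §1–§2

0-weight TOOL toward `TightDefectClasses.TowerDictionary` (decomp-res lens-5, g39; plan `Dictionary-plan-v2.md`,
architecture S′, Layer A).  `ShallowPort3.chain` grows ring maps `φ_i : 𝒪_{X_i,x_i} → L` whose KERNEL is the marked stalk
ideal; the dictionary needs instead INJECTIVE maps `ψ_i : 𝒪_{X_i,x_i} ↪ L` (so that the equation `f_i` of the marked
ideal survives in `L` and can be compared with the polynomial normal form `Z^q + F_i(u)` of a `K`-frame, `FrameStep.lean`).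

* §1 `chartToField_injective_of_injective` — for an injective `ψ : R ↪ L` (field `L`, domain `R`) and `c_j ≠ 0` the chart
  map `ψ₁ : R[𝔪/c_j] → L` (`chartToField`) is injective; `exists_lift_of_injective` — it extends injectively to every
  localization of the chart at a prime.
* §2 `tower_step_inj` — THE STEP: an injective `ψ : 𝒪_{X_i,x_i} ↪ L` extends along `π_i^♯` to an injective
  `ψ' : 𝒪_{X_{i+1},x_{i+1}} ↪ L`; the image `ψ'(𝒪_{x_{i+1}})` is CERTIFIED (`ShallowPort.PointBlowupCert`) to be the point
  blow-up of `ψ(𝒪_{x_i})` in the chart of the certificate's parameter `c_j`, and every generator `f` of the marked stalk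
  ideal `(I_i)_{x_i}` factors in `𝒪_{x_{i+1}}` as `π^♯ f = w · (π^♯ c_j)^q · f'` with `w` a unit and `(I_{i+1})_{x_{i+1}} = (f')`
  (`IsBlowup.exists_stalkIdeal_map_eq_span_pow_mul` + `colon_span_pow_mul_eq_span`), stated in `L` through `ψ'`.
* §3 `IStage` (an injective stalk map + principality of the marked stalk ideal), `inextStage`, `inextCert`, `ichain` and the
  accessor lemmas `inextStage_comp`, `inextStage_dominates`, `inextStage_fact` (certificate + factorization between
  consecutive stages), `exists_generator_ichain`.
* §4 `exists_iStage_zero` — stage `0` from `Rooted`: `𝒪_{X_0,x_0} = k[u][Z]_𝔮 ↪ L`, `a/s ↦ χ a / χ s`, for any injective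
  `χ : k[u][Z] ↪ L`; `𝔮 ∋ Z^q + F` maximal, `ψ₀ f₀ = χ(Z^q + F)`, image `= {χ a / χ s : s ∉ 𝔮}`.

(Slice 1/2 of the farm-checked monolith `StalkThread.lean` (decomp-res lens-5 g39): §1–§2 here, §3–§4 in `StalkThread2.lean`.)
All PROVED, 0 sorry.  Sources: [HerrmannIkedaOrbanz1988, Thm. (30.2) (proof)], [Kollar2007, §1.4, 3.58–3.60],
[CossartPiltant2019, §2.2], [StacksProject, Tag 0804, 07Z3].
-/

noncomputable section

set_option linter.dupNamespace false

open IsLocalRing IsLocalization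
open Literature.AlgebraicGeometry.Resolution

namespace Summit.ResolutionOfSingularities.ResolutionOfSingularities.Theorems.StalkThread

open Summit.ResolutionOfSingularities.ResolutionOfSingularities.Theorems.ShallowPort

/-! ## §1 Injective chart maps -/

section Chart

universe u

variable {R : Type u} [CommRing R] [IsDomain R] {n : ℕ} (c : Fin n → R) (j : Fin n)
  {L : Type} [Field L] (ψ : R →+* L)

/-- **The chart map of an injective `ψ : R ↪ L` is injective**: if `ψ₁(b) = 0` then, writing `φ(c_j)^k b = φ(r)`
(`exists_pow_mul_eq_reesChartBase`), `ψ r = 0`, `r = 0` and `b = 0` (`c_j` is a non-zero-divisor of the chart).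
[cite: StacksProject, Tag 07Z3] -/
theorem chartToField_injective_of_injective (hψ : Function.Injective ψ) (hcj : c j ≠ 0) :
    Function.Injective (chartToField c j ψ ((map_ne_zero_iff ψ hψ).mpr hcj)) := by
  have hmem := Ideal.mem_span_range_self (f := c) (x := j)
  haveI : IsDomain (Localization.Away (c j)) :=
    IsLocalization.isDomain_localization (powers_le_nonZeroDivisors_of_noZeroDivisors hcj)
  refine (injective_iff_map_eq_zero _).mpr fun b hb => ?_
  obtain ⟨k, r, h⟩ := exists_pow_mul_eq_reesChartBase c j b
  have hr : ψ r = 0 := by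
    by_contra hr
    exact ((chartToField_ne_zero_iff c j ψ ((map_ne_zero_iff ψ hψ).mpr hcj) h).mpr hr) hb
  have hr0 : r = 0 := hψ (by rw [hr, map_zero])
  rw [hr0, map_zero] at h
  apply reesChart_injective (c j) hmem
  have h' := congrArg (reesChart (c j) hmem) h
  rw [RingHom.map_mul, RingHom.map_pow, reesChart_reesChartBase, map_zero] at h'
  rw [map_zero]
  refine (mul_eq_zero.mp h').resolve_left (pow_ne_zero k ?_)
  exact fun h0 => hcj ((IsLocalization.to_map_eq_zero_iff (S := Localization.Away (c j))
    (powers_le_nonZeroDivisors_of_noZeroDivisors hcj)).mp h0)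

/-- **Injective extension to a localization of the chart at a prime.** [cite: StacksProject, Tag 07Z3] -/
theorem exists_lift_of_injective (hψ : Function.Injective ψ) (hcj : c j ≠ 0) (𝔴 : Ideal (chartRing c j)) [𝔴.IsPrime]
    (S : Type u) [CommRing S] [Algebra (chartRing c j) S] [IsLocalization.AtPrime S 𝔴] :
    ∃ ψ' : S →+* L, Function.Injective ψ' ∧
      ∀ b, ψ' ((algebraMap (chartRing c j) S : chartRing c j →+* S) b) =
        chartToField c j ψ ((map_ne_zero_iff ψ hψ).mpr hcj) b := by
  have hinj := chartToField_injective_of_injective c j ψ hψ hcj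
  have hunits : ∀ s : 𝔴.primeCompl,
      IsUnit (chartToField c j ψ ((map_ne_zero_iff ψ hψ).mpr hcj) s) := fun s =>
    isUnit_iff_ne_zero.mpr fun h => s.2 (by
      have : (s : chartRing c j) = 0 := hinj (by rw [h, map_zero])
      rw [this]; exact 𝔴.zero_mem)
  refine ⟨IsLocalization.lift (M := 𝔴.primeCompl) hunits, ?_, fun b => IsLocalization.lift_eq _ b⟩
  refine (IsLocalization.lift_injective_iff _).mpr fun x y => ⟨fun h => ?_, fun h => ?_⟩
  · obtain ⟨s, hs⟩ := IsLocalization.exists_of_eq (M := 𝔴.primeCompl) h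
    have := congrArg (chartToField c j ψ ((map_ne_zero_iff ψ hψ).mpr hcj)) hs
    rw [map_mul, map_mul] at this
    exact mul_left_cancel₀ (hunits s).ne_zero this
  · rw [hinj h]

end Chart

/-! ## §2 The kernel-zero step along the tower -/

section Step

open CategoryTheory AlgebraicGeometry TopologicalSpace Topology
open Scheme.IdealSheafData
open Summit.ResolutionOfSingularities.ResolutionOfSingularities.Theorems.ForcedTowerClasses
open Summit.ResolutionOfSingularities.ResolutionOfSingularities.Theorems.HugValuationCut

variable {X X' : Scheme.{0}} {π : X' ⟶ X}

set_option maxHeartbeats 800000 in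
/-- **The kernel-zero step at a point blow-up** (the injective twin of
`ShallowPort.exists_extension_ker_eq_controlledTransform`).  `π : X' → X` the blowing up of the regular locally Noetherian
`X` at the closed point `x = π(x')`, `J_x = (h)` principal of order `μ`, the weak transform `J'_{x'} ≠ 0`,
`ψ : 𝒪_{X,x} ↪ L` INJECTIVE.  Then `ψ` extends along `π^♯_{x'}` to an injective `ψ'`, `ψ'(𝒪_{X',x'})` is the certified point
blow-up of `ψ(𝒪_{X,x})`, and every generator `f` of `J_x` factors as `ψ f = ψ' w · ψ(c_j)^μ · ψ' f'`, `w` a unit,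
`J'_{x'} = (f')`. [cite: HerrmannIkedaOrbanz1988, Thm. (30.2) (proof)] [cite: Kollar2007, 3.58–3.60] [cite: StacksProject, Tag 0804] -/
theorem exists_injective_extension
    [IsLocallyNoetherian X] [IsLocallyNoetherian X'] (hX : Scheme.IsRegular X) (hX' : Scheme.IsRegular X')
    {x' : X'} (hcl : IsClosed ({π.base x'} : Set X))
    (hreg : Scheme.IsRegular (vanishingIdeal (⟨{π.base x'}, hcl⟩ : Closeds X)).subscheme)
    (hπ : IsBlowup π (vanishingIdeal (⟨{π.base x'}, hcl⟩ : Closeds X)))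
    (J : X.IdealSheafData) {μ : ℕ} (hord : idealOrder J (π.base x') = μ)
    (hJ : (stalkIdeal J (π.base x')).IsPrincipal)
    (hne : stalkIdeal (controlledTransform π (vanishingIdeal (⟨{π.base x'}, hcl⟩ : Closeds X)) J μ) x' ≠ ⊥)
    {L : Type} [Field L] (ψ : X.presheaf.stalk (π.base x') →+* L) (hψ : Function.Injective ψ) :
    ∃ (ψ' : X'.presheaf.stalk x' →+* L)
      (cert : PointBlowupCert ψ.range ψ'.range ((maximalIdeal (X.presheaf.stalk (π.base x'))).map ψ.rangeRestrict)),
      Function.Injective ψ' ∧ (∀ a, ψ' ((π.stalkMap x').hom a) = ψ a) ∧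
      (stalkIdeal (controlledTransform π (vanishingIdeal (⟨{π.base x'}, hcl⟩ : Closeds X)) J μ) x').IsPrincipal ∧
      ∀ f, stalkIdeal J (π.base x') = Ideal.span {f} →
        ∃ f' w, IsUnit w ∧
          stalkIdeal (controlledTransform π (vanishingIdeal (⟨{π.base x'}, hcl⟩ : Closeds X)) J μ) x' = Ideal.span {f'} ∧
          ψ f = ψ' w * ((cert.c cert.j : ψ.range) : L) ^ μ * ψ' f' := by
  classical
  haveI hA : IsRegularLocalRing (X.presheaf.stalk (π.base x')) := hX _
  haveI hO : IsRegularLocalRing (X'.presheaf.stalk x') := hX' _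
  haveI : IsDomain (X'.presheaf.stalk x') := isDomain_of_isRegularLocalRing _
  haveI : IsDomain (X.presheaf.stalk (π.base x')) := isDomain_of_isRegularLocalRing _
  -- generators `c` of `𝔪_x`, a Rees chart `χ : 𝒪_{X,x}[𝔪/c_j] → 𝒪_{X',x'}` presenting the stalk as a localization
  obtain ⟨r, c, hc𝔪⟩ := Submodule.fg_iff_exists_fin_generating_family.mp
    (IsNoetherian.noetherian (maximalIdeal (X.presheaf.stalk (π.base x'))))
  have hc𝔪' : Ideal.span (Set.range c) = maximalIdeal (X.presheaf.stalk (π.base x')) := hc𝔪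
  have hcY : Ideal.span (Set.range c) =
      stalkIdeal (vanishingIdeal (⟨{π.base x'}, hcl⟩ : Closeds X)) (π.base x') := by
    rw [stalkIdeal_vanishingIdeal_singleton]; exact hc𝔪'
  obtain ⟨j, 𝔴, χ, hχ, hloc, -⟩ := hπ.exists_reesChart_stalk x' c hcY
  letI : Algebra (chartRing c j) (X'.presheaf.stalk x') := χ.toAlgebra
  haveI : IsLocalization.AtPrime (X'.presheaf.stalk x') 𝔴.asIdeal := hloc
  have hχ' : ∀ b, algebraMap (chartRing c j) (X'.presheaf.stalk x') b = χ b := fun b =>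
    RingHom.congr_fun (RingHom.algebraMap_toAlgebra χ) b
  -- the total transform `J_x 𝒪_{X',x'} = (e^μ g')`
  have hY : ∀ y ∈ ((⟨{π.base x'}, hcl⟩ : Closeds X) : Set X), idealOrder J y = μ := by
    intro y hy
    obtain rfl : y = π.base x' := hy
    exact hord
  have hxY : π.base x' ∈ ((⟨{π.base x'}, hcl⟩ : Closeds X) : Set X) := Set.mem_singleton _
  obtain ⟨e, g', hE, hmap, henzd, heprime, hg'e⟩ := hπ.exists_stalkIdeal_map_eq_span_pow_mul hX hreg hY hxY hJ
  have he0 : e ≠ 0 := nonZeroDivisors.ne_zero henzd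
  -- the weak transform `J'_{x'} = (g')`
  have hctrl : stalkIdeal (controlledTransform π (vanishingIdeal (⟨{π.base x'}, hcl⟩ : Closeds X)) J μ) x' =
      Ideal.span {g'} := by
    rw [controlledTransform, stalkIdeal_colon, stalkIdeal_pow, stalkIdeal_comap_eq_map_stalkMap π J, hmap, hE]
    exact colon_span_pow_mul_eq_span he0 g' μ
  have hg'0 : g' ≠ 0 := by
    intro h0
    apply hne
    rw [hctrl, h0, Ideal.span_singleton_eq_bot]
  -- the exceptional parameter: `(e) = 𝔪_x 𝒪_{X',x'} = (c_j)`, so `c_j = u e` with `u` a unit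
  have hcl' : ∀ l, (π.stalkMap x').hom (c l) = (π.stalkMap x').hom (c j) * χ (chartGen c j l) := by
    intro l
    rw [← hχ, ← hχ, ← RingHom.map_mul, ← reesChartBase_apply_eq_mul_chartGen c j l]
  have hEc : Ideal.span {e} = Ideal.span {(π.stalkMap x').hom (c j)} := by
    rw [← hE, stalkIdeal_comap_eq_map_stalkMap π, ← hcY, Ideal.map_span]
    apply le_antisymm
    · apply Ideal.span_le.mpr
      rintro _ ⟨_, ⟨l, rfl⟩, rfl⟩
      rw [SetLike.mem_coe, hcl' l]
      exact Ideal.mul_mem_right _ _ (Ideal.mem_span_singleton_self _)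
    · apply Ideal.span_le.mpr
      rintro _ ⟨⟩
      exact Ideal.subset_span ⟨c j, ⟨j, rfl⟩, rfl⟩
  obtain ⟨u, hunit, hu⟩ : ∃ u, IsUnit u ∧ (π.stalkMap x').hom (c j) = u * e := by
    have h1 : (π.stalkMap x').hom (c j) ∈ Ideal.span {e} := hEc ▸ Ideal.mem_span_singleton_self _
    have h2 : e ∈ Ideal.span {(π.stalkMap x').hom (c j)} := hEc ▸ Ideal.mem_span_singleton_self _
    obtain ⟨a, ha⟩ := Ideal.mem_span_singleton'.mp h1
    obtain ⟨b, hb⟩ := Ideal.mem_span_singleton'.mp h2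
    refine ⟨a, ?_, ha.symm⟩
    have h3 : (b * a - 1) * e = 0 := by rw [sub_mul, mul_assoc, ha, hb, one_mul, sub_self]
    have hba : b * a = 1 := sub_eq_zero.mp ((mul_eq_zero.mp h3).resolve_right he0)
    exact IsUnit.of_mul_eq_one b (by rw [mul_comm]; exact hba)
  -- `c_j ≠ 0`
  have hcj : c j ≠ 0 := by
    intro h0
    have h1 : u * e = 0 := by rw [← hu, h0, map_zero]
    exact he0 ((mul_eq_zero.mp h1).resolve_left hunit.ne_zero)
  have hψcj : ψ (c j) ≠ 0 := (map_ne_zero_iff ψ hψ).mpr hcj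
  -- the injective extension `ψ'` of the chart map `ψ₁ = chartToField c j ψ`
  obtain ⟨ψ', hψ'inj, hψ'χ0⟩ := exists_lift_of_injective c j ψ hψ hcj 𝔴.asIdeal (X'.presheaf.stalk x')
  have hψ'χ : ∀ b, ψ' (χ b) = chartToField c j ψ hψcj b := fun b => by rw [← hχ' b]; exact hψ'χ0 b
  have hcomp : ∀ a, ψ' ((π.stalkMap x').hom a) = ψ a := fun a => by
    rw [← hχ, hψ'χ, chartToField_reesChartBase]
  -- the chart closure contains `ψ₁` of everything
  have hsub : Subring.closure (Set.range ψ ∪ Set.range fun l => ψ (c l) / ψ (c j)) ≤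
      chartClosure ψ.range (fun l => ψ.rangeRestrict (c l)) j := by
    rw [Subring.closure_le]
    rintro z (⟨a, rfl⟩ | ⟨l, rfl⟩)
    · exact Subring.subset_closure (Or.inl ⟨a, rfl⟩)
    · exact Subring.subset_closure (Or.inr ⟨ψ.rangeRestrict (c l), ⟨l, rfl⟩, rfl⟩)
  have hθcl : ∀ b, chartToField c j ψ hψcj b ∈ chartClosure ψ.range (fun l => ψ.rangeRestrict (c l)) j :=
    fun b => hsub (by rw [← range_chartToField c j ψ hψcj]; exact ⟨b, rfl⟩)
  -- the certificate
  have cert_span : ((maximalIdeal (X.presheaf.stalk (π.base x'))).map ψ.rangeRestrict) =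
      Ideal.span (Set.range fun l => ψ.rangeRestrict (c l)) := by
    rw [← hc𝔪', Ideal.map_span, ← Set.range_comp]
    rfl
  have cert_ne : (fun l => ψ.rangeRestrict (c l)) j ≠ 0 := by
    intro h0
    exact hψcj (by simpa using congrArg Subtype.val h0)
  have cert_le : chartClosure ψ.range (fun l => ψ.rangeRestrict (c l)) j ≤ ψ'.range := by
    rw [chartClosure, Subring.closure_le]
    rintro z (hz | ⟨y, ⟨l, rfl⟩, rfl⟩)
    · obtain ⟨a, rfl⟩ := (RingHom.mem_range.mp hz)
      exact ⟨(π.stalkMap x').hom a, hcomp a⟩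
    · exact ⟨χ (chartGen c j l), by rw [hψ'χ, chartToField_chartGen]; rfl⟩
  have cert_frac : ∀ x ∈ ψ'.range, ∃ y ∈ chartClosure ψ.range (fun l => ψ.rangeRestrict (c l)) j,
      ∃ z ∈ chartClosure ψ.range (fun l => ψ.rangeRestrict (c l)) j, z ≠ 0 ∧ z⁻¹ ∈ ψ'.range ∧ x = y / z := by
    rintro _ ⟨z, rfl⟩
    obtain ⟨⟨b, s⟩, rfl⟩ := IsLocalization.mk'_surjective 𝔴.asIdeal.primeCompl z
    have hs0 : chartToField c j ψ hψcj s ≠ 0 := fun h0 => s.2 (by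
      have : (s : chartRing c j) = 0 := chartToField_injective_of_injective c j ψ hψ hcj (by rw [h0, map_zero])
      rw [this]; exact 𝔴.asIdeal.zero_mem)
    have h1 : ψ' (IsLocalization.mk' (X'.presheaf.stalk x') b s) * chartToField c j ψ hψcj s =
        chartToField c j ψ hψcj b := by
      rw [← hψ'χ s, ← hψ'χ b, ← RingHom.map_mul, ← hχ' (s : chartRing c j), IsLocalization.mk'_spec, hχ']
    refine ⟨chartToField c j ψ hψcj b, hθcl b, chartToField c j ψ hψcj s, hθcl s, hs0, ?_, ?_⟩
    · refine ⟨IsLocalization.mk' (X'.presheaf.stalk x') 1 s, eq_inv_of_mul_eq_one_left ?_⟩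
      rw [← hψ'χ s, ← hχ' (s : chartRing c j), ← RingHom.map_mul, IsLocalization.mk'_spec, hχ', hψ'χ, map_one]
    · rw [eq_div_iff hs0]
      exact h1
  refine ⟨ψ', ⟨r, fun l => ψ.rangeRestrict (c l), j, cert_span.symm, cert_ne, cert_le, cert_frac⟩, hψ'inj, hcomp,
    hctrl ▸ ⟨⟨g', rfl⟩⟩, ?_⟩
  -- the factorization of a generator `f` of `J_x`
  intro f hf
  have h1 : Ideal.span {(π.stalkMap x').hom f} = Ideal.span {e ^ μ * g'} := by
    rw [← hmap, hf, Ideal.map_span, Set.image_singleton]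
  have h2 : (π.stalkMap x').hom f ∈ Ideal.span {e ^ μ * g'} := h1 ▸ Ideal.mem_span_singleton_self _
  have h3 : e ^ μ * g' ∈ Ideal.span {(π.stalkMap x').hom f} := h1 ▸ Ideal.mem_span_singleton_self _
  obtain ⟨t, ht⟩ := Ideal.mem_span_singleton'.mp h2
  obtain ⟨t', ht'⟩ := Ideal.mem_span_singleton'.mp h3
  have heg : e ^ μ * g' ≠ 0 := mul_ne_zero (pow_ne_zero _ he0) hg'0
  have htt : t' * t = 1 := by
    have h4 : (t' * t - 1) * (e ^ μ * g') = 0 := by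
      rw [sub_mul, mul_assoc, ht, ht', one_mul, sub_self]
    exact sub_eq_zero.mp ((mul_eq_zero.mp h4).resolve_right heg)
  have htunit : IsUnit t := IsUnit.of_mul_eq_one t' (by rw [mul_comm]; exact htt)
  obtain ⟨uu, huu⟩ := hunit
  -- `e = uu⁻¹ · π^♯ c_j`
  have he : e = ↑uu⁻¹ * (π.stalkMap x').hom (c j) := by
    rw [hu, ← huu, ← mul_assoc, Units.inv_mul, one_mul]
  refine ⟨g', t * ↑(uu⁻¹ ^ μ), htunit.mul (Units.isUnit _), hctrl, ?_⟩
  have h5 : (π.stalkMap x').hom f = t * ↑(uu⁻¹ ^ μ) * (π.stalkMap x').hom (c j) ^ μ * g' := by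
    rw [← ht, he, mul_pow, Units.val_pow_eq_pow_val]
    ring
  change ψ f = ψ' (t * ↑(uu⁻¹ ^ μ)) * ψ (c j) ^ μ * ψ' g'
  rw [← hcomp f, h5, map_mul, map_mul, map_pow, hcomp]

/-- **The kernel-zero step along the forced tower.**  An injective `ψ : 𝒪_{X_i,x_i} ↪ L` with `(I_i)_{x_i}` principal
extends along `π_i^♯` to an injective `ψ' : 𝒪_{X_{i+1},x_{i+1}} ↪ L` with `(I_{i+1})_{x_{i+1}}` principal, a certificate that
`ψ'(𝒪_{x_{i+1}})` is the point blow-up of `ψ(𝒪_{x_i})` in the chart of `c_j`, and the factorization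
`ψ f_i = ψ' w · ψ(c_j)^q · ψ' f_{i+1}` (`w` a unit) of every generator `f_i` of `(I_i)_{x_i}`.
[cite: HerrmannIkedaOrbanz1988, Thm. (30.2) (proof)] [cite: CossartPiltant2019, §2.2] -/
theorem tower_step_inj {k : Type} [Field k] (T : ForcedTower) (g : T.St 0 ⟶ Spec (.of k)) (hB : IsBase (T.St 0) g)
    {q : ℕ} (hD : IsDatum q (T.D 0)) (i : ℕ) {L : Type} [Field L]
    (ψ : (T.St i).presheaf.stalk (T.pt i) →+* L) (hψ : Function.Injective ψ)
    (hpr : (stalkIdeal (T.D i).ideal (T.pt i)).IsPrincipal) :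
    ∃ (ψ' : (T.St (i + 1)).presheaf.stalk (T.pt (i + 1)) →+* L)
      (cert : PointBlowupCert ψ.range ψ'.range ((maximalIdeal _).map ψ.rangeRestrict)),
      Function.Injective ψ' ∧
      (∀ a, ψ' (((T.π i).stalkMap (T.pt (i + 1))).hom a) =
        ψ (((T.St i).presheaf.stalkCongr (.of_eq (T.pt_map i))).hom.hom a)) ∧
      SubringDominates ψ.range ψ'.range ∧
      (stalkIdeal (T.D (i + 1)).ideal (T.pt (i + 1))).IsPrincipal ∧
      ∀ f, stalkIdeal (T.D i).ideal (T.pt i) = Ideal.span {f} →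
        ∃ f' w, IsUnit w ∧ stalkIdeal (T.D (i + 1)).ideal (T.pt (i + 1)) = Ideal.span {f'} ∧
          ψ f = ψ' w * ((cert.c cert.j : ψ.range) : L) ^ q * ψ' f' := by
  haveI : IsLocallyNoetherian (T.St i) := (tower_isLocallyNoetherian_isRegular T g hB i).1
  haveI : IsLocallyNoetherian (T.St (i + 1)) := (tower_isLocallyNoetherian_isRegular T g hB (i + 1)).1
  have hX : Scheme.IsRegular (T.St i) := (tower_isLocallyNoetherian_isRegular T g hB i).2
  have hX' : Scheme.IsRegular (T.St (i + 1)) := (tower_isLocallyNoetherian_isRegular T g hB (i + 1)).2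
  -- non-vanishing of the transformed stalk ideal
  have hne1 : stalkIdeal (T.D (i + 1)).ideal (T.pt (i + 1)) ≠ ⊥ := by
    intro h0
    have hord := tower_idealOrder_pt_eq T g hB hD (i + 1)
    have hle : (((q + 1 : ℕ) : ℕ) : ℕ∞) ≤ idealOrder (T.D (i + 1)).ideal (T.pt (i + 1)) := by
      rw [le_idealOrder_iff, h0]
      exact bot_le
    rw [hord] at hle
    have := ENat.coe_le_coe.mp hle
    omega
  -- the step at a general point `x = π_i(x_{i+1})` of `X_i`
  have key : ∀ (x : T.St i) (hx : (T.π i).base (T.pt (i + 1)) = x) (hc : IsClosed ({x} : Set (T.St i))),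
      Scheme.IsRegular (vanishingIdeal (⟨{x}, hc⟩ : Closeds (T.St i))).subscheme →
      IsBlowup (T.π i) (vanishingIdeal (⟨{x}, hc⟩ : Closeds (T.St i))) →
      (T.D (i + 1)).ideal = controlledTransform (T.π i) (vanishingIdeal (⟨{x}, hc⟩ : Closeds (T.St i))) (T.D i).ideal q →
      idealOrder (T.D i).ideal x = ((q : ℕ) : ℕ∞) →
      ∀ (ψ : (T.St i).presheaf.stalk x →+* L), Function.Injective ψ →
      (stalkIdeal (T.D i).ideal x).IsPrincipal →
      ∃ (ψ' : (T.St (i + 1)).presheaf.stalk (T.pt (i + 1)) →+* L)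
        (cert : PointBlowupCert ψ.range ψ'.range ((maximalIdeal _).map ψ.rangeRestrict)),
        Function.Injective ψ' ∧
        (∀ a, ψ' (((T.π i).stalkMap (T.pt (i + 1))).hom a) =
          ψ (((T.St i).presheaf.stalkCongr (.of_eq hx)).hom.hom a)) ∧
        SubringDominates ψ.range ψ'.range ∧
        (stalkIdeal (T.D (i + 1)).ideal (T.pt (i + 1))).IsPrincipal ∧
        ∀ f, stalkIdeal (T.D i).ideal x = Ideal.span {f} →
          ∃ f' w, IsUnit w ∧ stalkIdeal (T.D (i + 1)).ideal (T.pt (i + 1)) = Ideal.span {f'} ∧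
            ψ f = ψ' w * ((cert.c cert.j : ψ.range) : L) ^ q * ψ' f' := by
    intro x hx
    subst hx
    intro hc hreg hbl hsucc hordx ψ hψ hpr
    have hsc : ∀ a, (((T.St i).presheaf.stalkCongr
        (.of_eq (rfl : (T.π i).base (T.pt (i + 1)) = (T.π i).base (T.pt (i + 1))))).hom.hom a) = a := fun a => by
      change ((T.St i).presheaf.stalkSpecializes (specializes_refl _)).hom a = a
      rw [TopCat.Presheaf.stalkSpecializes_refl]
      rfl
    have hne : stalkIdeal (controlledTransform (T.π i) (vanishingIdeal (⟨{(T.π i).base (T.pt (i + 1))}, hc⟩ :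
        Closeds (T.St i))) (T.D i).ideal q) (T.pt (i + 1)) ≠ ⊥ := by
      rw [← hsucc]; exact hne1
    obtain ⟨ψ', cert, h1, h2, h3, h4⟩ := exists_injective_extension hX hX' hc hreg hbl (T.D i).ideal hordx hpr hne ψ hψ
    refine ⟨ψ', cert, h1, fun a => by rw [hsc, h2], subringDominates_range ((T.π i).stalkMap (T.pt (i + 1))).hom ψ ψ' h2, ?_, ?_⟩
    · rw [hsucc]; exact h3
    · intro f hf
      obtain ⟨f', w, hw, hf', hfac⟩ := h4 f hf
      exact ⟨f', w, hw, by rw [hsucc]; exact hf', hfac⟩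
  have hreg := T.centre_regular i
  rw [tower_centre_eq_vanishingIdeal T i] at hreg
  exact key (T.pt i) (T.pt_map i) (T.isClosed_pt i) hreg (tower_isBlowup_vanishingIdeal T i)
    (tower_ideal_succ_eq_controlledTransform T hD i) (tower_idealOrder_pt_eq T g hB hD i) ψ hψ hpr

end Step

end Summit.ResolutionOfSingularities.ResolutionOfSingularities.Theorems.StalkThread
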